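import Summits.ABC.IUTFork.Joshi.ArithTeichmullerFrobeniusScalar
import Summits.ABC.IUTFork.Joshi.UntiltFrobeniusLine
import HarnessLib

/-!
# A MODEL inhabiting the reading datum «`φ` = the Lubin–Tate scalar `π`»: the Frobenius-SCALAR line — `φ := ×ℓ` on `ℚ^×/±1`,
# of infinite order, Frobenius-compatible moves for every `σ`, `K_{φ(y)} ≅ K_y` topologically while `φ` DILATES every point

Model file of the abc-iut cell, branch E (seat abc-iut-E-t1 gen 4, [J-I] carrier owner; rung LADDER-ABC:A2.E), over this seat's BUILT
parents `UntiltFrobeniusLine` (p438828: the Frobenius line `frobLine`, `FrobLine.idx`, `mulLin`) and `ArithTeichmullerFrobeniusScalar`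
(p443500: the reading datum `UntiltPoints.FrobScalarDatum`, `frobCompatible_of_frobScalar`, `xPtEquiv`, `projActPerm`). TAKES NO SIDE
on [IUTchIII] Cor. 3.12 or on any author (Mochizuki / Scholze–Stix / Joshi / Dupuy–Hilado); a model EXHIBITS joint satisfiability of
typed hypotheses, nothing more; typed ≠ proved ≠ endorsed; no test line vs `S` arises here.

WHY. p443500 derives [J-I] v4 Thm 5.21.1 (4) for EVERY `σ` (`frobCompatible_of_frobScalar`) and (5.20.3) (`xPtEquiv`) from the
hypothesis-object `FrobScalarDatum D` («along (5.20.2) the Frobenius of `|𝒴_{F,E}|` is multiplication by a scalar `π` acting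
bijectively on `𝒢(𝒪_F)`», p.33 last line – p.34 l.2), which that file never instantiates (no Fargues–Fontaine curve in the tree;
gen-3 HANDOFF residue). The signature's two earlier models leave the Frobenius field TRIVIAL (`threePoint` p432361, `frobLine`
p438828: `frob := Equiv.refl`). This file closes the non-vacuity floor HONESTLY, i.e. with a Frobenius of INFINITE order obeying
the printed law of a Frobenius translate: `𝒪_E := ℤ`, `𝒢 := ℚ` (discrete), `|𝒴| := ℚ^×/±1`, `φ := ×ℓ` (`ℓ` a fixed prime),
`π := ℓ ∈ ℤ`, residue field of `[x]` = `ℂ_p` with the norm raised to `b^{v_ℓ(x)}` (`b > 0`); so `‖·‖_{K_{φ(y)}} = ‖·‖^b_{K_y}` at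
every point — at `b = p` the miniature of «`|x|_{K_{φ(y)}} = |x|^p_{K_y}`» ([J-I] v4 §5.19 / Thm 5.21.1 (4); render of record
`HOME/plan/repair/lit/renders/Joshi-ATS1-2106.11452v4-PDFpaged-book-anonnd/`). [claim: Joshi2021ATS1, status: disputed] for
the notions modelled; every theorem below is [folklore] about the model.

WHAT IS HERE (ns `Summit.ABC.IUTFork.Joshi`, auxiliaries in `FrobScalarLine`).
* §1 `FrobScalarLine.frobPerm ℓ` = `×ℓ` as a permutation of `ℚ^×/±1`; `idx_frobPerm` (`v_ℓ` goes up by one), `idx_frobPerm_zpow`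
  (`idx (φⁿ y) = n + idx y`), **`frobPerm_zpow_eq_self_iff`** (`φⁿ y = y ↔ n = 0`: INFINITE order, no periodic point),
  `zsmul_ell_bijective`, `frobPerm_eq_projAct_scalarEquiv` (`×ℓ` IS p443500's scalar `ℓ • (·)` on the quotient).
* §2 **`frobScalarLine p ℓ b hb : UntiltPoints p ℤ`** (the signature with `frob := frobPerm ℓ`) and **`frobScalarLineDatum :
  (frobScalarLine p ℓ b hb).FrobScalarDatum`** — THE READING DATUM INHABITED (`π := ℓ`). Consequences BY NAME, nothing restated:
  `frobScalarLine_frobCompatible` (p431235's `FrobCompatible σ` for EVERY `σ`, via `frobCompatible_of_frobScalar`),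
  `frobScalarLine_frobPreservesUntilt` (p429850's named Prop `FrobPreservesUntilt`: `K_{φ(y)} ≅ K_y` topologically).
* §3 the Frobenius law: `exponent_frobScalarLine` (`= b^{idx y}`), **`exponent_frob`** (`exponent (φ y) = b · exponent y`),
  `exponent_frob_zpow` (`= bⁿ · exponent y`), **`isDilatation_frob`** (`IsDilatation y (φ y) b`), `norm_algCl_frob`
  (`‖x‖_{K_{φ(y)}} = ‖x‖^b_{K_y}` on `Q̄_p`), `exponent_frob_ne` (`b ≠ 1`: `φ` is NOT isometric although `K_{φ(y)} ≅ K_y`),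
  `frob_zpow_eq_self_iff`; `FrobScalarLine.ellAut` (the move `×ℓ ∈ Aut_ℤ(ℚ)`) with **`ptAct_ellAut`** (in the model `φ` IS a move:
  under the reading datum `φ = π • (·)` is `𝒪_E`-linear), `frobScalarLine_actionDilates`; `existsUnique_idx_frob_zpow_eq_zero` (every
  `φ`-orbit meets the slice `idx = 0` exactly once: a fundamental domain for `|𝒳| = |𝒴|/φ^ℤ` in the model).
NOT modelled / not claimed: the Kedlaya–Temkin non-homeomorphy `ExistsNonIsomorphic` (all residue fields here are homeomorphic), any
property of the actual Fargues–Fontaine curve. Standard axioms only.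
-/

noncomputable section

namespace Summit.ABC.IUTFork.Joshi

open UntiltPoints FrobLine

/-! ## 1. The model Frobenius `×ℓ` on `ℚ^×/±1` -/

namespace FrobScalarLine

variable (ℓ : ℕ) [hℓ : Fact ℓ.Prime]

/-- `ℓ ≠ 0` in `ℚ`. [folklore] -/
theorem ell_ne_zero : (ℓ : ℚ) ≠ 0 := Nat.cast_ne_zero.2 hℓ.out.ne_zero

/-- **The model Frobenius**: multiplication by `ℓ` as a PERMUTATION of `ℚ^×/±1` (p443500's `projActPerm` of p438828's `mulLin ℓ`).
[folklore] -/
def frobPerm : Equiv.Perm (ProjPoints ℤ ℚ) := projActPerm (mulLin (ℓ : ℚ) (ell_ne_zero ℓ))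

/-- It is `projAct (mulLin ℓ)`. [folklore] -/
theorem frobPerm_apply (y : ProjPoints ℤ ℚ) : frobPerm ℓ y = projAct (mulLin (ℓ : ℚ) (ell_ne_zero ℓ)) y := rfl

/-- It moves `[x]` to `[ℓ·x]`. [folklore] -/
theorem frobPerm_pt (x : ℚ) (hx : x ≠ 0) :
    frobPerm ℓ (pt x hx) = pt ((ℓ : ℚ) * x) (mul_ne_zero (ell_ne_zero ℓ) hx) :=
  Quotient.sound ⟨1, one_smul _ _⟩

/-- **`×ℓ` raises the `ℓ`-adic index by one**: `idx (φ y) = 1 + idx y`. [folklore] -/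
theorem idx_frobPerm (y : ProjPoints ℤ ℚ) : idx ℓ (frobPerm ℓ y) = 1 + idx ℓ y := by
  rw [frobPerm_apply, idx_projAct, mulLin_apply, mul_one, padicValRat.self hℓ.out.one_lt]

/-- … `φ⁻¹ = ×ℓ⁻¹` lowers it by one … [folklore] -/
theorem idx_frobPerm_inv (y : ProjPoints ℤ ℚ) : idx ℓ ((frobPerm ℓ)⁻¹ y) = -1 + idx ℓ y := by
  have h := idx_frobPerm ℓ ((frobPerm ℓ)⁻¹ y)
  rw [Equiv.Perm.inv_def, Equiv.apply_symm_apply] at h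
  rw [Equiv.Perm.inv_def]
  omega

/-- … hence `idx (φⁿ y) = n + idx y` for every `n ∈ ℤ`. [folklore] -/
theorem idx_frobPerm_zpow (n : ℤ) (y : ProjPoints ℤ ℚ) : idx ℓ ((frobPerm ℓ ^ n) y) = n + idx ℓ y := by
  induction n using Int.induction_on generalizing y with
  | zero => simp
  | succ i ih => rw [zpow_add_one, Equiv.Perm.mul_apply, ih, idx_frobPerm]; ring
  | pred i ih => rw [zpow_sub_one, Equiv.Perm.mul_apply, ih, idx_frobPerm_inv]; ring

/-- **The model Frobenius has INFINITE order**: `φⁿ y = y` iff `n = 0` (no point is `φ`-periodic). [folklore] -/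
theorem frobPerm_zpow_eq_self_iff (n : ℤ) (y : ProjPoints ℤ ℚ) : (frobPerm ℓ ^ n) y = y ↔ n = 0 := by
  constructor
  · intro h
    have hidx := idx_frobPerm_zpow ℓ n y
    rw [h] at hidx
    omega
  · rintro rfl
    simp

/-- The scalar `ℓ ∈ ℤ = 𝒪_E` acts bijectively on `𝒢 = ℚ` (the «`E`-vector space» clause of the datum). [folklore] -/
theorem zsmul_ell_bijective : Function.Bijective fun g : ℚ => ((ℓ : ℤ)) • g := by
  have h : (fun g : ℚ => ((ℓ : ℤ)) • g) = fun g => (ℓ : ℚ) * g := by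
    funext g
    rw [zsmul_eq_mul, Int.cast_natCast]
  rw [h]
  exact mulLeft_bijective₀ (ℓ : ℚ) (ell_ne_zero ℓ)

/-- On `ℚ^×/±1`, `×ℓ` IS p443500's scalar action `projAct (scalarEquiv ℓ _)`. [folklore] -/
theorem frobPerm_eq_projAct_scalarEquiv (y : ProjPoints ℤ ℚ) :
    frobPerm ℓ y = projAct (scalarEquiv ((ℓ : ℤ)) (zsmul_ell_bijective ℓ)) y := by
  induction y using Quotient.inductionOn' with
  | h g =>
    rw [frobPerm_apply, projAct_mk, projAct_mk]
    exact congrArg _ (Subtype.ext (by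
      show (ℓ : ℚ) * (g : ℚ) = ((ℓ : ℤ)) • (g : ℚ)
      simp only [zsmul_eq_mul, Int.cast_natCast]))

end FrobScalarLine

/-! ## 2. The Frobenius-scalar line and its reading datum (the datum INHABITED) -/

open FrobScalarLine

variable (p ℓ : ℕ) [Fact p.Prime] [hℓ : Fact ℓ.Prime]

/-- **The FROBENIUS-SCALAR LINE** `frobScalarLine p ℓ b hb`: p438828's Frobenius line (`𝒪_E := ℤ`, `𝒢 := ℚ` discrete, `|𝒴| := ℚ^×/±1`,
residue field of `[x]` the rescaled `ℂ_p^{(b^{v_ℓ(x)})}`, preferred algebraic closures the completion map) with the Frobenius field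
now the permutation `φ := ×ℓ` of INFINITE order — the orbit `…, [ℓ⁻¹], [1], [ℓ], [ℓ²], …` of `[1]` IS a `φ`-orbit and carries the
exponents `…, b⁻¹, 1, b, b², …`. A MODEL of the signature `UntiltPoints`; no claim of Joshi's is used or asserted. [folklore] -/
def frobScalarLine (b : ℝ) (hb : 0 < b) : UntiltPoints p ℤ where
  Pt := ProjPoints ℤ ℚ
  untilt y := Untilt.rescaled p (b ^ idx ℓ y) (zpow_idx_pos hb y)
  frob := frobPerm ℓ
  algCl y := algClRescaled p (b ^ idx ℓ y) (zpow_idx_pos hb y)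
  continuous_algCl y := continuous_algClRescaled p (b ^ idx ℓ y) (zpow_idx_pos hb y)
  G := ℚ
  topologicalSpace := ⊥
  ptEquiv := Equiv.refl _

variable {p ℓ} (b : ℝ) (hb : 0 < b)

/-- The Frobenius of the model is `×ℓ` (unfolding). [folklore] -/
theorem frob_frobScalarLine (y : (frobScalarLine p ℓ b hb).Pt) : (frobScalarLine p ℓ b hb).frob y = frobPerm ℓ y := rfl

/-- … and so are its integer powers. [folklore] -/
theorem frob_zpow_frobScalarLine (n : ℤ) (y : (frobScalarLine p ℓ b hb).Pt) :
    ((frobScalarLine p ℓ b hb).frob ^ n) y = (frobPerm ℓ ^ n) y := rfl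

/-- **THE READING DATUM `FrobScalarDatum` INHABITED** on the Frobenius-scalar line, with `π := ℓ`: along `ptEquiv = id`,
`φ = ×ℓ` is multiplication by the scalar `ℓ ∈ ℤ`, which acts bijectively on `ℚ`. So p443500's hypothesis-object is satisfiable by a
signature whose Frobenius has infinite order (`frob_zpow_eq_self_iff`). A model, nothing more. [folklore] -/
def frobScalarLineDatum : (frobScalarLine p ℓ b hb).FrobScalarDatum where
  π := (ℓ : ℤ)
  bij := zsmul_ell_bijective ℓ
  frob_eq y := frobPerm_eq_projAct_scalarEquiv ℓ y

/-- Its scalar is `ℓ`. [folklore] -/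
theorem frobScalarLineDatum_π : (frobScalarLineDatum b hb : (frobScalarLine p ℓ b hb).FrobScalarDatum).π = (ℓ : ℤ) := rfl

/-- **Every move `σ ∈ Aut_ℤ(ℚ)` is Frobenius-compatible on the model** — p431235's well-definedness condition of Thm 5.21.1 (4),
obtained BY NAME from p443500's `frobCompatible_of_frobScalar` at the inhabited datum (so that derivation is about an inhabited
hypothesis). [folklore] -/
theorem frobScalarLine_frobCompatible (σ : (frobScalarLine p ℓ b hb).Aut) : (frobScalarLine p ℓ b hb).FrobCompatible σ :=
  (frobScalarLineDatum b hb).frobCompatible_of_frobScalar σ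

/-- **`FrobPreservesUntilt` HOLDS on the model**: `K_{φ(y)}` and `K_y` are topologically isomorphic (both are `ℂ_p`, rescaled
differently; p432361's `rescaled_topIso`) — p429850's named Prop is satisfiable TOGETHER WITH a dilating Frobenius (§3). [folklore] -/
theorem frobScalarLine_frobPreservesUntilt : (frobScalarLine p ℓ b hb).FrobPreservesUntilt := fun _ =>
  rescaled_topIso p _ _ _ _

/-! ## 3. The Frobenius law `‖·‖_{K_{φ(y)}} = ‖·‖^b_{K_y}`: `φ` dilates every point, is a move, and is not isometric -/

/-- The scaling exponent of p431060 at a point of the model IS `b ^ idx y` (same residue fields as `frobLine`). [folklore] -/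
theorem exponent_frobScalarLine (y : (frobScalarLine p ℓ b hb).Pt) : (frobScalarLine p ℓ b hb).exponent y = b ^ idx ℓ y :=
  exponent_frobLine (p := p) (ℓ := ℓ) b hb y

/-- **`exponent (φ y) = b · exponent y`** at EVERY point. [folklore] -/
theorem exponent_frob (y : (frobScalarLine p ℓ b hb).Pt) :
    (frobScalarLine p ℓ b hb).exponent ((frobScalarLine p ℓ b hb).frob y) = b * (frobScalarLine p ℓ b hb).exponent y := by
  rw [exponent_frobScalarLine, exponent_frobScalarLine, frob_frobScalarLine, idx_frobPerm, zpow_add₀ hb.ne', zpow_one]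

/-- … and `exponent (φⁿ y) = bⁿ · exponent y` along the whole orbit (the miniature of `‖·‖_{K_{φⁿ(y)}} = ‖·‖^{pⁿ}_{K_y}`). [folklore] -/
theorem exponent_frob_zpow (n : ℤ) (y : (frobScalarLine p ℓ b hb).Pt) :
    (frobScalarLine p ℓ b hb).exponent (((frobScalarLine p ℓ b hb).frob ^ n) y) = b ^ n * (frobScalarLine p ℓ b hb).exponent y := by
  rw [exponent_frobScalarLine, exponent_frobScalarLine, frob_zpow_frobScalarLine, idx_frobPerm_zpow, zpow_add₀ hb.ne']

/-- **The Frobenius DILATES every point by the factor `b`**: `IsDilatation y (φ y) b` (p429850's reading predicate). [folklore] -/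
theorem isDilatation_frob (y : (frobScalarLine p ℓ b hb).Pt) :
    (frobScalarLine p ℓ b hb).IsDilatation y ((frobScalarLine p ℓ b hb).frob y) b := by
  rw [UntiltPoints.isDilatation_iff_eq_div, exponent_frob, mul_div_assoc,
    div_self ((frobScalarLine p ℓ b hb).exponent_pos y).ne', mul_one]

/-- The same, read on the preferred algebraic closures: `‖x‖_{K_{φ(y)}} = ‖x‖^b_{K_y}` for every `x ∈ Q̄_p`. [folklore] -/
theorem norm_algCl_frob (y : (frobScalarLine p ℓ b hb).Pt) (x : AlgebraicClosure ℚ_[p]) :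
    ‖(frobScalarLine p ℓ b hb).algCl ((frobScalarLine p ℓ b hb).frob y) x‖ = ‖(frobScalarLine p ℓ b hb).algCl y x‖ ^ b :=
  isDilatation_frob b hb y x

/-- For `b ≠ 1` the Frobenius CHANGES the exponent: `φ` is not isometric on `Q̄_p`, although `K_{φ(y)} ≅ K_y` topologically
(`frobScalarLine_frobPreservesUntilt`) — dilatation without change of topology. [folklore] -/
theorem exponent_frob_ne (hb1 : b ≠ 1) (y : (frobScalarLine p ℓ b hb).Pt) :
    (frobScalarLine p ℓ b hb).exponent ((frobScalarLine p ℓ b hb).frob y) ≠ (frobScalarLine p ℓ b hb).exponent y := by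
  rw [exponent_frob]
  intro h
  exact hb1 ((mul_eq_right₀ ((frobScalarLine p ℓ b hb).exponent_pos y).ne').1 h)

/-- `φⁿ y = y` iff `n = 0` on the model (infinite order, restated on the signature's `frob`). [folklore] -/
theorem frob_zpow_eq_self_iff (n : ℤ) (y : (frobScalarLine p ℓ b hb).Pt) :
    ((frobScalarLine p ℓ b hb).frob ^ n) y = y ↔ n = 0 :=
  frobPerm_zpow_eq_self_iff ℓ n y

/-- **Every `φ`-orbit meets the slice `idx = 0` exactly once**: a fundamental domain for `|𝒳| = |𝒴|/φ^ℤ` in the model (p443500's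
`xPtEquiv` identifies `|𝒳|` with the `ℓ^ℤ`-orbit quotient of `ℚ^×/±1` BY NAME). [folklore] -/
theorem existsUnique_idx_frob_zpow_eq_zero (y : (frobScalarLine p ℓ b hb).Pt) :
    ∃! n : ℤ, idx ℓ (((frobScalarLine p ℓ b hb).frob ^ n) y) = 0 := by
  refine ⟨-idx ℓ y, ?_, fun n hn => ?_⟩
  · show idx ℓ ((frobPerm ℓ ^ (-idx ℓ y)) y) = 0
    rw [idx_frobPerm_zpow]
    omega
  · have h : idx ℓ ((frobPerm ℓ ^ n) y) = 0 := hn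
    rw [idx_frobPerm_zpow] at h
    omega

namespace FrobScalarLine

/-- **The move `×ℓ ∈ Aut_ℤ(ℚ)`** (a continuous `ℤ`-linear automorphism of the discrete `𝒢 = ℚ`). [folklore] -/
def ellAut : (frobScalarLine p ℓ b hb).Aut :=
  { mulLin (ℓ : ℚ) (ell_ne_zero ℓ) with
    continuous_toFun := continuous_bot
    continuous_invFun := continuous_bot }

/-- **In the model the Frobenius IS a move**: `ptAct (×ℓ) = φ` (under the reading datum `φ = π • (·)` is `𝒪_E`-linear; here it is
also continuous). [folklore] -/
theorem ptAct_ellAut (y : (frobScalarLine p ℓ b hb).Pt) :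
    (frobScalarLine p ℓ b hb).ptAct (ellAut b hb) y = (frobScalarLine p ℓ b hb).frob y := rfl

end FrobScalarLine

/-- **`ActionDilates` HOLDS on the Frobenius-scalar line** (`b ≠ 1`), witnessed by the Frobenius move itself. [folklore] -/
theorem frobScalarLine_actionDilates (hb1 : b ≠ 1) : (frobScalarLine p ℓ b hb).ActionDilates :=
  ⟨FrobScalarLine.ellAut b hb, pt 1 one_ne_zero, b, hb, hb1, isDilatation_frob b hb _⟩

/-- Summary conjunction (the JOINT satisfiability exhibited): the reading datum is inhabited, every move is Frobenius-compatible,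
`FrobPreservesUntilt` and `ActionDilates` hold together, and `φ` has no periodic point. A model, nothing more. [folklore] -/
theorem frobScalarLine_summary (hb1 : b ≠ 1) :
    Nonempty (frobScalarLine p ℓ b hb).FrobScalarDatum ∧
      (∀ σ, (frobScalarLine p ℓ b hb).FrobCompatible σ) ∧
      (frobScalarLine p ℓ b hb).FrobPreservesUntilt ∧ (frobScalarLine p ℓ b hb).ActionDilates ∧
      ∀ (n : ℤ) (y : (frobScalarLine p ℓ b hb).Pt), ((frobScalarLine p ℓ b hb).frob ^ n) y = y → n = 0 :=
  ⟨⟨frobScalarLineDatum b hb⟩, frobScalarLine_frobCompatible b hb, frobScalarLine_frobPreservesUntilt b hb,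
    frobScalarLine_actionDilates b hb hb1, fun n y h => (frob_zpow_eq_self_iff b hb n y).1 h⟩

end Summit.ABC.IUTFork.Joshi

end
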